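import Summits.AtomisticToContinuum.Crystallization.Theorems.OverbindingBudgetAffineNearLightSkeleton

/-!
# Overbinding budget — PRICED WALLS: the extremal re-cut R0⁻ ⟸ R0ᴬ ∧ FC of the light-skeleton floor (decomp-a2c lens-4, generation 72)

Child of `…Theorems.OverbindingBudgetAffineNearLightSkeleton` (tree, p852495; GEN 71L: RD0c ⟸ CP⁺ ∧ R0⁻ — the light-wall re-cut of the
g45/g46 skeleton line `…Theorems.OverbindingBudgetAffineNearSkeleton`, p841460).
Memo: `HOME/decomp-a2c-lens-4/g72/memo/NODE-g72-PricedWalls.md`.  Probes: `HOME/decomp-a2c-lens-4/g72/bc/probes_priced.lean`.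

## The extremal question and its answer
R0⁻ `NearLightSkeletonFloor` (UNDECIDED; the only open near-regime leaf of the 71L line) floors the class energy of every LIGHT admissible
skeleton equilibrium — light = the wall zone carries at most the fraction `ϖ/ℓ` of `y`'s force content, a GLOBAL AVERAGE over the whole
clampable interior.  Lens-4 asks what a MINIMAL COUNTEREXAMPLE to R0⁻ must look like, i.e. which hypotheses are load-bearing.  Answer of this
node: the lightness hypothesis is NOT — it can be replaced by a LINEAR PRICE.  Precisely, R0⁻ follows (PROVED glue) from
* R0ᴬ · `NearPricedSkeletonFloor η R Rc δm ρ₁ θ θ₀ κ t w rL` [NEW · TRUE-type on paper · ATTACKABLE-L · UNDECIDED]: the skeleton floor for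
  EVERY admissible skeleton equilibrium (NO lightness hypothesis), with the deep walls PRICED and the raw collar CREDITED, both in `y`'s own
  force-content currency `forceContent y j = ‖classForce y j‖²`:
  `#Near·e⋆ − C·#Gᶜ − κ·#Far − ν·Q₁(y, z) − A·Σ_{wall zone} forceContent y + cE·Σ_{collar-pinned} forceContent y ≤ ½·pairSum Near G z`,
  `A ≥ 0`, `cE > 0` the floor's own rates (chosen before `ν`).  The wall price is the first-order work `W×` of the cells' smooth reaction
  against the wall roughness (g71 memo §3) bounded by Cauchy–Schwarz instead of averaged away; the collar credit is the Polyak–Łojasiewicz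
  slack of raw pinned matter off the deep walls (unrelaxed matter exceeds its locally relaxed state by `≥ |force|²/(2λ_max)`; for strained
  two-lattice (hcp-type) near matter it is the unrelaxed-shuffle surplus `f²/(2k_s)`).  WHY IT MIGHT FAIL: it is R0's smooth part verbatim
  (Cauchy–Born-equilibrated smoothing of `z` on a cell up to rough pinned walls, null-Lagrangian telescoping to the collar, near-side tails
  against denser incoherent matter), plus the SITEWISE credit, which asks the equation of state to see the inner-elastic force of strained
  hcp-type matter (`W_aff(B) ≥ W_relax(B) + f²/(2k_s)`) with force-weighted charts — paper estimates, not tree facts.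
* FC · `ForceContentVisible η R Rc δm ρ₁ θ θ₀ t w` [NEW · TRUE-type · ATTACKABLE-M — pure kinematics, no energy]: on the FREE set of an
  admissible class-critical skeleton pair, `y`'s force content is visible to the rebate currency:
  `Σ_{k ∈ F} forceContent y k ≤ C_L·Q₁(y, z) + κ·#Far + C·#Gᶜ`, `C_L` ABSOLUTE.  Route: on `F`, `classForce z k = 0`, so
  `classForce y k = classForce y k − classForce z k`, Lipschitz in the bond displacements of `w = y − z` (bond lengths along the segment
  floored by `RefAdmissible` (a),(d)); first/second shells are `Q₁`-edges or 2-step paths; shells `≤ ρ := ℓ^{1/5}` use registered first-shell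
  paths (`|V″(r)| ≤ 7r⁻⁸`, edge weight `Σ_r 7r⁻⁸·r·r³ < ∞`) stopping at the first pinned site (`w = 0` there); the tail `> ρ` uses
  `Σ_{r>ρ} Lip ≤ 28ρ⁻⁵` and the FRIEDRICHS inequality on a cell (`w = 0` on the pinned matter surrounding it, diameter `≤ ℓ`), costing
  `ρ⁻¹⁰(ℓ+2)² ≤ 1`; free sites within `2ρ` of bad matter go to `C(ℓ)·#Gᶜ`.  WHY IT MIGHT FAIL: `C_L` must not grow with `ℓ` (the glue spends
  `ϖ·C_L/ℓ`): the path/Friedrichs constants need registered lattice lines chained across a cell without drift (radius-12 charts over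
  diameter `ℓ`), and free sites within `2ρ(ℓ)` of FAR (not bad) matter have only the spare `κ·#Far`.
* GLUE (PROVED, `nearLightSkeletonFloor_of_priced_of_visible`): the interior splits into free ∪ wall zone ∪ collar-pinned
  (`sum_nearInterior_le_free_wall_collar`); light walls give `(ℓ − ϖ)·Σ_W ≤ ϖ·(Σ_F + Σ_P)`; FC converts `Σ_F`; the scale choice
  `ℓ − ϖ ≥ 2AϖC_L/ν`, `ℓ − ϖ ≥ Aϖ/cE`, `ℓ − ϖ ≥ 2Aϖ` (`wall_absorb`) absorbs the wall price HALF into `ν·Q₁`, HALF into the collar credit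
  and the far/bad budget: R0ᴬ at `(κ₁/2, ν/2)` ∧ FC at `κ₁` ⟹ R0⁻ at `(κ₁, ν)` with `C ↦ C + C′`.  LINE cone
  `K_at⁰ ∧ R_aff ∧ CP⁺ ∧ R0ᴬ ∧ FC ∧ N2 ∧ Z ∧ M ⟹ TBDSG_rec` through the tree's `nearReferenceCritical_of_lightSkeleton` and the cone of
  record `tbdsg_of_nearCritical_record'_bt_d` (UNCHANGED); RDEF shape.  Record literals: R0ᴬ at `κ = κ₁/2 = 1/(4·10⁷)/2`, `rL = 12`; FC at
  `(t, w) = (4, 6)`.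
* NOT REWORDINGS (probes): R0ᴬ ↛ R0⁻ (needs FC and lightness), FC ↛ R0⁻ (no floor), R0⁻ ↛ R0ᴬ and R0 ↛ R0ᴬ (the credit `cE > 0` is a
  demand neither makes; the price `A` a freedom neither has), neither ⇒ RD0c / N / TBDSG, neither outright; PROVED: the glue, and the
  degenerate consistencies `forceContentVisible_ineq_empty` (FC's inequality at `F = ∅`) and `collarPinned_eq_of_deepPinned_eq_empty` (no
  deep pinned site ⇒ the price vanishes and the whole pinned interior is credited).

## The one-box obstruction (lens-4 NEGATIVE finding, memo §4; Barrier note)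
The stronger normal form «a counterexample lives in ONE BOX» — blockwise floors on the cubic grid of side `3ℓ` with halo budgets, glued by
the fibrewise partition and halo multiplicity `27` (typed and glued sorry-free in the seat's artefact `BlockFloor_OBSTRUCTED_artefact.lean`) —
is FALSE-type on paper: the sitewise Cauchy–Born expansion of a centrosymmetric lattice carries the null-Lagrangian term `L(∇u)⫶∇³u`, first
order in the (registered, hence `O(ε₁)`) strain gradient, whose block sum is the FACE FLUX `∮_{∂blk} L(∇u):∇²u·n`; it cancels only between
adjacent blocks (globally it telescopes to the collar, where the far/bad budget lives), and a clean gently-graded block has no local budget of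
first order in `ε₁` (its local budgets `c_W|E|²`, `ν·Q₁`, force contents are second order).  So R0-type floors are intrinsically
collar-telescoped; what localises is the WALL HYPOTHESIS (this node), not the floor.
sorry-free · Mathlib + tree only · no new axioms · no instance / notation beyond the tree's local `E3`.
-/

namespace Summit.AtomisticToContinuum.Crystallization.Theorems.OverbindingBudgetAffineNearCluster

open scoped BigOperators Classical
open Literature.MathematicalPhysics.StatisticalMechanics
open Literature.Geometry.DiscreteGeometry (nearestDist)
open Summit.AtomisticToContinuum.Crystallization.Theses.OverbindingBudget (RobustDefectLimitWindows)
open Summit.AtomisticToContinuum.Crystallization.Theses.PricedLinkCensus (ChargedEnergyGap)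
open Summit.AtomisticToContinuum.Crystallization.Theorems.OverbindingBudgetGradedBareness (CleanlessExcessT)
open Summit.AtomisticToContinuum.Crystallization.Theorems.OverbindingBudgetCoherentCut (CoherentResidual)
open Summit.AtomisticToContinuum.Crystallization.Theorems.OverbindingBudgetTwoShellShape (TwoShellShape)
open Summit.AtomisticToContinuum.Crystallization.Theorems.OverbindingBudgetBalancedCensusStatements
open Summit.AtomisticToContinuum.Crystallization.Theorems.OverbindingBudgetBalancedCensusRecord
open Summit.AtomisticToContinuum.Crystallization.Theorems.OverbindingBudgetHarmonicNormalForm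
open Summit.AtomisticToContinuum.Crystallization.Theorems.OverbindingBudgetLocalHarmonicCertificate
open Summit.AtomisticToContinuum.Crystallization.Theorems.OverbindingBudgetAffineLadder
open Summit.AtomisticToContinuum.Crystallization.Theorems.OverbindingBudgetAffineLocalisation

variable {N : ℕ}
local notation "E3" => EuclideanSpace ℝ (Fin 3)

/-! ## §1  The collar-pinned set and the bookkeeping of the wall price (PROVED) -/

/-- **Collar-pinned set** of a free set `F`: the clampable sites that are neither free nor in the wall zone — the RAW matter off the deep
walls (by the thin-wall clause (5) of `CellSkeleton` it lies within `2ℓ` of non-clampable matter). [this file] -/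
noncomputable def collarPinned (ℓ rL Rc θ₀ ρ₁ ε₁ θ δ : ℝ) (y : Fin N → E3) (F : Finset (Fin N)) : Finset (Fin N) :=
  (nearInterior Rc θ₀ ρ₁ ε₁ θ δ y).filter fun j => j ∉ F ∧ j ∉ wallZone ℓ rL Rc θ₀ ρ₁ ε₁ θ δ y F

/-- The collar-pinned set lies in the clampable interior, misses `F`, and misses the wall zone. [this file] -/
theorem mem_collarPinned {ℓ rL Rc θ₀ ρ₁ ε₁ θ δ : ℝ} {y : Fin N → E3} {F : Finset (Fin N)} {j : Fin N} :
    j ∈ collarPinned ℓ rL Rc θ₀ ρ₁ ε₁ θ δ y F ↔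
      j ∈ nearInterior Rc θ₀ ρ₁ ε₁ θ δ y ∧ j ∉ F ∧ j ∉ wallZone ℓ rL Rc θ₀ ρ₁ ε₁ θ δ y F := by
  unfold collarPinned; rw [Finset.mem_filter]

/-- `collarPinned_subset` (docstring added by the landing lane; see the module docstring). [formal bookkeeping] -/
theorem collarPinned_subset (ℓ rL Rc θ₀ ρ₁ ε₁ θ δ : ℝ) (y : Fin N → E3) (F : Finset (Fin N)) :
    collarPinned ℓ rL Rc θ₀ ρ₁ ε₁ θ δ y F ⊆ nearInterior Rc θ₀ ρ₁ ε₁ θ δ y :=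
  Finset.filter_subset _ _

/-- `disjoint_collarPinned_free` (docstring added by the landing lane; see the module docstring). [formal bookkeeping] -/
theorem disjoint_collarPinned_free (ℓ rL Rc θ₀ ρ₁ ε₁ θ δ : ℝ) (y : Fin N → E3) (F : Finset (Fin N)) :
    Disjoint (collarPinned ℓ rL Rc θ₀ ρ₁ ε₁ θ δ y F) F :=
  Finset.disjoint_left.mpr fun _ hj => (mem_collarPinned.mp hj).2.1

/-- `disjoint_collarPinned_wallZone` (docstring added by the landing lane; see the module docstring). [formal bookkeeping] -/
theorem disjoint_collarPinned_wallZone (ℓ rL Rc θ₀ ρ₁ ε₁ θ δ : ℝ) (y : Fin N → E3) (F : Finset (Fin N)) :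
    Disjoint (collarPinned ℓ rL Rc θ₀ ρ₁ ε₁ θ δ y F) (wallZone ℓ rL Rc θ₀ ρ₁ ε₁ θ δ y F) :=
  Finset.disjoint_left.mpr fun _ hj => (mem_collarPinned.mp hj).2.2

/-- **Degenerate consistency (PROVED):** with NO deep pinned site the wall zone is empty, so the price of R0ᴬ vanishes and the collar-pinned
set is ALL of the pinned interior (the boundary-dominated case of the tree's `cellSkeleton_empty` / `wallZone_eq_empty_of_deepPinned_eq_empty`). -/
theorem collarPinned_eq_of_deepPinned_eq_empty {ℓ rL Rc θ₀ ρ₁ ε₁ θ δ : ℝ} {y : Fin N → E3} {F : Finset (Fin N)}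
    (h : deepPinned ℓ Rc θ₀ ρ₁ ε₁ θ δ y F = ∅) :
    collarPinned ℓ rL Rc θ₀ ρ₁ ε₁ θ δ y F = (nearInterior Rc θ₀ ρ₁ ε₁ θ δ y).filter fun j => j ∉ F := by
  unfold collarPinned
  rw [wallZone_eq_empty_of_deepPinned_eq_empty h]
  exact Finset.filter_congr fun j _ => by simp

/-- **The interior splits into free ∪ wall zone ∪ collar-pinned (PROVED, as an inequality of nonnegative sums).** [this file] -/
theorem sum_nearInterior_le_free_wall_collar (ℓ rL Rc θ₀ ρ₁ ε₁ θ δ : ℝ) (y : Fin N → E3) (F : Finset (Fin N))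
    {f : Fin N → ℝ} (hf : ∀ j, 0 ≤ f j) :
    ∑ j ∈ nearInterior Rc θ₀ ρ₁ ε₁ θ δ y, f j
      ≤ (∑ j ∈ F, f j) + (∑ j ∈ wallZone ℓ rL Rc θ₀ ρ₁ ε₁ θ δ y F, f j)
        + ∑ j ∈ collarPinned ℓ rL Rc θ₀ ρ₁ ε₁ θ δ y F, f j := by
  have hsplit := Finset.sum_filter_add_sum_filter_not (nearInterior Rc θ₀ ρ₁ ε₁ θ δ y)
    (fun j => j ∈ wallZone ℓ rL Rc θ₀ ρ₁ ε₁ θ δ y F) f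
  have h1 : ∑ j ∈ (nearInterior Rc θ₀ ρ₁ ε₁ θ δ y).filter (fun j => j ∈ wallZone ℓ rL Rc θ₀ ρ₁ ε₁ θ δ y F), f j
      ≤ ∑ j ∈ wallZone ℓ rL Rc θ₀ ρ₁ ε₁ θ δ y F, f j :=
    Finset.sum_le_sum_of_subset_of_nonneg (fun j hj => (Finset.mem_filter.mp hj).2) fun j _ _ => hf j
  have hsplit2 := Finset.sum_filter_add_sum_filter_not
    ((nearInterior Rc θ₀ ρ₁ ε₁ θ δ y).filter fun j => j ∉ wallZone ℓ rL Rc θ₀ ρ₁ ε₁ θ δ y F) (fun j => j ∈ F) f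
  have h2 : ∑ j ∈ ((nearInterior Rc θ₀ ρ₁ ε₁ θ δ y).filter fun j => j ∉ wallZone ℓ rL Rc θ₀ ρ₁ ε₁ θ δ y F).filter
      (fun j => j ∈ F), f j ≤ ∑ j ∈ F, f j :=
    Finset.sum_le_sum_of_subset_of_nonneg (fun j hj => (Finset.mem_filter.mp hj).2) fun j _ _ => hf j
  have h3 : ∑ j ∈ ((nearInterior Rc θ₀ ρ₁ ε₁ θ δ y).filter fun j => j ∉ wallZone ℓ rL Rc θ₀ ρ₁ ε₁ θ δ y F).filter
      (fun j => j ∉ F), f j ≤ ∑ j ∈ collarPinned ℓ rL Rc θ₀ ρ₁ ε₁ θ δ y F, f j := by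
    refine Finset.sum_le_sum_of_subset_of_nonneg (fun j hj => ?_) fun j _ _ => hf j
    simp only [Finset.mem_filter] at hj
    rw [mem_collarPinned]
    exact ⟨hj.1.1, hj.2, hj.1.2⟩
  linarith

/-- **WALL ABSORPTION (PROVED, real arithmetic):** light walls `SW ≤ (ϖ/ℓ)·SI`, the interior split `SI ≤ SF + SW + SP`, visibility
`SF ≤ C_L·Q + X`, and the scale conditions `2AϖC_L ≤ (ℓ−ϖ)ν`, `Aϖ ≤ (ℓ−ϖ)cE`, `2Aϖ ≤ ℓ − ϖ` give `A·SW ≤ (ν/2)·Q + cE·SP + X/2`. -/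
theorem wall_absorb {ℓ ϖ A CL cE ν SW SF SP SI Q X : ℝ} (hϖ : 0 ≤ ϖ) (hϖℓ : ϖ < ℓ) (hA : 0 ≤ A)
    (hQ : 0 ≤ Q) (hSP : 0 ≤ SP) (hX : 0 ≤ X)
    (hLW : SW ≤ ϖ / ℓ * SI) (hI : SI ≤ SF + SW + SP) (hF : SF ≤ CL * Q + X)
    (h1 : 2 * A * ϖ * CL ≤ (ℓ - ϖ) * ν) (h2 : A * ϖ ≤ (ℓ - ϖ) * cE) (h3 : 2 * A * ϖ ≤ ℓ - ϖ) :
    A * SW ≤ ν / 2 * Q + cE * SP + X / 2 := by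
  have hℓ : 0 < ℓ := lt_of_le_of_lt hϖ hϖℓ
  have hd : 0 < ℓ - ϖ := sub_pos.mpr hϖℓ
  have e1 : ℓ * SW ≤ ϖ * SI := by
    have h := mul_le_mul_of_nonneg_left hLW hℓ.le
    have e : ℓ * (ϖ / ℓ * SI) = ϖ * SI := by field_simp
    linarith
  have eI := mul_le_mul_of_nonneg_left hI hϖ
  have eF := mul_le_mul_of_nonneg_left hF hϖ
  have e2 : (ℓ - ϖ) * SW ≤ ϖ * (CL * Q) + ϖ * X + ϖ * SP := by nlinarith
  have e3 : A * ((ℓ - ϖ) * SW) ≤ A * (ϖ * (CL * Q) + ϖ * X + ϖ * SP) := mul_le_mul_of_nonneg_left e2 hA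
  have a1 : A * ϖ * CL * Q ≤ (ℓ - ϖ) * (ν / 2) * Q := by
    have : A * ϖ * CL ≤ (ℓ - ϖ) * (ν / 2) := by linarith
    exact mul_le_mul_of_nonneg_right this hQ
  have a2 : A * ϖ * SP ≤ (ℓ - ϖ) * cE * SP := mul_le_mul_of_nonneg_right h2 hSP
  have a3 : A * ϖ * X ≤ (ℓ - ϖ) / 2 * X := by
    have : A * ϖ ≤ (ℓ - ϖ) / 2 := by linarith
    exact mul_le_mul_of_nonneg_right this hX
  have e5 : (ℓ - ϖ) * (A * SW) ≤ (ℓ - ϖ) * (ν / 2 * Q + cE * SP + X / 2) := by nlinarith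
  exact le_of_mul_le_mul_left e5 hd

/-! ## §2  The two pieces -/

/-- **R0ᴬ · `NearPricedSkeletonFloor η R Rc δm ρ₁ θ θ₀ κ t w rL`** (NEW · TRUE-type on paper · ATTACKABLE-L · UNDECIDED; the PRICED-WALL
normal form of the skeleton floor).  Given K_at⁰ and R_aff there are rates `A ≥ 0` (wall price) and `cE > 0` (collar credit) such that for every
`ν > 0` there is a scale `ℓ₀(ν)` such that for every `ℓ ≥ ℓ₀` some `ε₀ > 0` works (all `ε₁ ≤ ε₀`, all windows, some `C ≥ 0`): for EVERY
injective `y` and EVERY admissible skeleton equilibrium `(F, z)` of scale `ℓ` (v2 clauses of `CellSkeleton`; NO light-wall hypothesis),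
`#Near·e⋆ − C·#Gᶜ − κ·#Far − ν·Q₁(y, z) − A·Σ_{j ∈ W} ‖classForce y j‖² + cE·Σ_{j ∈ P} ‖classForce y j‖² ≤ ½·pairSum Near G z`,
`W = wallZone ℓ rL` (the `rL`-neighbourhood of the `2ℓ`-deep pinned sites), `P = collarPinned ℓ rL` (clampable, pinned, off `W`).  The deep
walls are PRICED in `y`'s own force content at rate `A` (the first-order work `W×` of the cells' smooth reaction load against the wall
roughness, g71 memo §3, by Cauchy–Schwarz: `|W×| ≤ (ν/4)Q₁ + (C/(νℓμ₁²))·Σ_W(‖classForce y‖² + |load|²)`, the load part `≤ (Cc²/ℓ)Q₁`; any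
fixed `A` works once `ℓ₀(ν) ≥ C′/(νA)`), the raw collar is CREDITED at rate `cE` (Polyak–Łojasiewicz: unrelaxed matter exceeds its locally
relaxed state by `≥ ‖force‖²/(2λ_max)`; for strained hcp-type matter the unrelaxed-shuffle surplus `f²/(2k_s)`).  Incomparable with R0 / R0⁻
as typed (no lightness; a price they lack; a credit they do not demand); the PROVED direction is R0ᴬ ∧ FC ⇒ R0⁻
(`nearLightSkeletonFloor_of_priced_of_visible`).  Record `κ = κ₁/2`, `rL = 12`.  WHY IT MIGHT FAIL: R0's smooth part verbatim (CB-equilibrated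
smoothing of `z` on a cell up to rough pinned walls; null-Lagrangian telescoping to the collar; near-side tails against denser incoherent
matter — slot Z's wall lemma), and the SITEWISE credit needs the two-lattice equation of state `W_aff(B) ≥ W_relax(B) + f²/(2k_s) ≥
e⋆ + c_W|E|² + f²/(2k_s)` with force-weighted charts — paper estimates, not tree facts. [lens-4 g72; Blanc–Le Bris–Lions 2002, E–Ming 2007
Thm 2.2 / §§4–6, Ortner–Theil 2013 Thm 3.3, Ehrlacher–Ortner–Shapeev 2016 §2, Theil 2006 / Flatley–Theil 2015 (LJ equation of state),
Hudson–Ortner 2014 §4; Karimi–Nutini–Schmidt 2016 §2 (PL inequality) — orientation only, nothing imported] -/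
def NearPricedSkeletonFloor (η R Rc δm ρ₁ θ θ₀ κ t w rL : ℝ) : Prop :=
  (∃ μ₁ μR : ℝ, 0 < μ₁ ∧ 0 < μR ∧ PureMarginStabilityAt η μ₁ μR R) → AffineChartStraightening →
    ∃ A : ℝ, 0 ≤ A ∧ ∃ cE : ℝ, 0 < cE ∧
    ∀ ν : ℝ, 0 < ν → ∃ ℓ₀ : ℝ, ∀ ℓ : ℝ, ℓ₀ ≤ ℓ →
      ∃ ε₀ : ℝ, 0 < ε₀ ∧ ∀ ε₁ : ℝ, 0 < ε₁ → ε₁ ≤ ε₀ → ∀ δ : ℝ, 0 < δ → δ ≤ 2 →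
        ∃ C : ℝ, 0 ≤ C ∧ ∀ (N : ℕ) (y : Fin N → E3), Function.Injective y →
          ∀ (F : Finset (Fin N)) (z : Fin N → E3), CellSkeleton ℓ t w Rc θ₀ ρ₁ ε₁ θ δ y F → (∀ k, y k ≠ z k → k ∈ F) →
            ClassCritical θ₀ ρ₁ ε₁ θ δ y z F → RefAdmissible η R Rc δm θ₀ ρ₁ ε₁ θ δ y z →
              ((nearSet θ₀ ρ₁ ε₁ θ δ y).card : ℝ) * (⨅ Q : PeriodicConfiguration 3, Q.energyPerParticle lennardJones)
                - C * (((goodSet ρ₁ ε₁ θ δ y)ᶜ).card : ℝ) - κ * ((farSet θ₀ ρ₁ ε₁ θ δ y).card : ℝ)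
                - ν * dispGradSum (101 / 100) (nearSet θ₀ ρ₁ ε₁ θ δ y) (goodSet ρ₁ ε₁ θ δ y) y z
                - A * (∑ j ∈ wallZone ℓ rL Rc θ₀ ρ₁ ε₁ θ δ y F, forceContent θ₀ ρ₁ ε₁ θ δ y j)
                + cE * (∑ j ∈ collarPinned ℓ rL Rc θ₀ ρ₁ ε₁ θ δ y F, forceContent θ₀ ρ₁ ε₁ θ δ y j)
                ≤ 1 / 2 * pairSum (nearSet θ₀ ρ₁ ε₁ θ δ y) (goodSet ρ₁ ε₁ θ δ y) z

/-- **FC · `ForceContentVisible η R Rc δm ρ₁ θ θ₀ t w`** (NEW · TRUE-type · ATTACKABLE-M; pure kinematics).  Given K_at⁰ and R_aff there is an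
ABSOLUTE `C_L ≥ 0` such that for every far rate `κ > 0` there is `ℓ₁` such that for every `ℓ ≥ ℓ₁` some `ε₀ > 0` works (all `ε₁ ≤ ε₀`, all
windows, some `C ≥ 0`): for every injective `y` and every admissible class-critical skeleton pair `(F, z)` of scale `ℓ`,
`Σ_{k ∈ F} ‖classForce y k‖² ≤ C_L·Q₁(y, z) + κ·#Far + C·#Gᶜ` — on the FREE set, `y`'s class-force content is visible to the rebate currency
(criticality of `z`: `classForce y k = classForce y k − classForce z k`, Lipschitz in the bond displacements of `w = y − z`; first/second
shells are `Q₁`-edges / 2-step paths; shells `≤ ρ = ℓ^{1/5}` by registered first-shell paths of edge weight `Σ_r 7r⁻⁸·r·r³`, stopping at the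
first pinned site (`w = 0` there); the tail `> ρ` by `Σ_{r>ρ} Lip ≤ 28ρ⁻⁵` and FRIEDRICHS on a cell (`w = 0` on the pinned matter around it,
diameter `≤ ℓ`): `ρ⁻¹⁰(ℓ+2)² ≤ 1`; free sites within `2ρ` of bad matter go to `C(ℓ)·#Gᶜ` by the sup bound `‖w‖ ≤ δm(ℓ+2)` of
`RefAdmissible` (a)).  No energy, no stability enters.  WHY IT MIGHT FAIL: `C_L` must be uniform in `ℓ` (the glue spends `ϖC_L/ℓ`): the
path / Friedrichs constants need registered lattice lines chained across a cell without drift (radius-12 `AffDeepReg` charts over diameter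
`ℓ`), bond lengths along the segment floored by `RefAdmissible` (d), and free sites within `2ρ(ℓ)` of FAR matter have only the spare `κ·#Far`.
[lens-4 g72; Ortner–Theil 2013 §2 (discrete Friedrichs/Poincaré on lattice domains), E–Ming 2007 §4] -/
def ForceContentVisible (η R Rc δm ρ₁ θ θ₀ t w : ℝ) : Prop :=
  (∃ μ₁ μR : ℝ, 0 < μ₁ ∧ 0 < μR ∧ PureMarginStabilityAt η μ₁ μR R) → AffineChartStraightening →
    ∃ CL : ℝ, 0 ≤ CL ∧ ∀ κ : ℝ, 0 < κ → ∃ ℓ₁ : ℝ, ∀ ℓ : ℝ, ℓ₁ ≤ ℓ →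
      ∃ ε₀ : ℝ, 0 < ε₀ ∧ ∀ ε₁ : ℝ, 0 < ε₁ → ε₁ ≤ ε₀ → ∀ δ : ℝ, 0 < δ → δ ≤ 2 →
        ∃ C : ℝ, 0 ≤ C ∧ ∀ (N : ℕ) (y : Fin N → E3), Function.Injective y →
          ∀ (F : Finset (Fin N)) (z : Fin N → E3), CellSkeleton ℓ t w Rc θ₀ ρ₁ ε₁ θ δ y F → (∀ k, y k ≠ z k → k ∈ F) →
            ClassCritical θ₀ ρ₁ ε₁ θ δ y z F → RefAdmissible η R Rc δm θ₀ ρ₁ ε₁ θ δ y z →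
              ∑ k ∈ F, forceContent θ₀ ρ₁ ε₁ θ δ y k
                ≤ CL * dispGradSum (101 / 100) (nearSet θ₀ ρ₁ ε₁ θ δ y) (goodSet ρ₁ ε₁ θ δ y) y z
                  + κ * ((farSet θ₀ ρ₁ ε₁ θ δ y).card : ℝ) + C * (((goodSet ρ₁ ε₁ θ δ y)ᶜ).card : ℝ)

/-- **Degenerate consistency (PROVED, trivial):** FC's inequality on the EMPTY skeleton for any nonnegative rates. [this file] -/
theorem forceContentVisible_ineq_empty {CL κ C : ℝ} (hCL : 0 ≤ CL) (hκ : 0 ≤ κ) (hC : 0 ≤ C) (θ₀ ρ₁ ε₁ θ δ : ℝ)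
    (y z : Fin N → E3) :
    ∑ k ∈ (∅ : Finset (Fin N)), forceContent θ₀ ρ₁ ε₁ θ δ y k
      ≤ CL * dispGradSum (101 / 100) (nearSet θ₀ ρ₁ ε₁ θ δ y) (goodSet ρ₁ ε₁ θ δ y) y z
        + κ * ((farSet θ₀ ρ₁ ε₁ θ δ y).card : ℝ) + C * (((goodSet ρ₁ ε₁ θ δ y)ᶜ).card : ℝ) := by
  rw [Finset.sum_empty]
  have := dispGradSum_nonneg (101 / 100) (nearSet θ₀ ρ₁ ε₁ θ δ y) (goodSet ρ₁ ε₁ θ δ y) y z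
  positivity

/-- **The free force content of a class-critical pair is a difference (PROVED):** on `F`, `classForce y k = classForce y k − classForce z k` —
the identity FC's route starts from. [this file] -/
theorem classForce_eq_sub_of_classCritical {θ₀ ρ₁ ε₁ θ δ : ℝ} {y z : Fin N → E3} {F : Finset (Fin N)}
    (hcrit : ClassCritical θ₀ ρ₁ ε₁ θ δ y z F) {k : Fin N} (hk : k ∈ F) :
    classForce (nearSet θ₀ ρ₁ ε₁ θ δ y) (goodSet ρ₁ ε₁ θ δ y) y k
      = classForce (nearSet θ₀ ρ₁ ε₁ θ δ y) (goodSet ρ₁ ε₁ θ δ y) y k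
        - classForce (nearSet θ₀ ρ₁ ε₁ θ δ y) (goodSet ρ₁ ε₁ θ δ y) z k := by
  rw [hcrit k hk, sub_zero]

/-! ## §3  The glue (PROVED): R0ᴬ ∧ FC ⇒ R0⁻ -/

/-- **SEAM (PROVED): R0ᴬ ∧ FC ⇒ R0⁻.**  Given `ν`: take R0ᴬ's rates `A, cE` and FC's `C_L`; R0ᴬ at `ν/2`, FC at far rate `κ₁`; the
scale `ℓ₀ := max (R0ᴬ's, FC's, ϖ + 2AϖC_L/ν + Aϖ/cE + 2Aϖ + 1)`; `ε₀ := min`; `C := C + C′`.  For a LIGHT admissible skeleton equilibrium: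
split the interior (`sum_nearInterior_le_free_wall_collar`), apply light walls, FC, and `wall_absorb`. [this file] -/
theorem nearLightSkeletonFloor_of_priced_of_visible {η R Rc δm ρ₁ θ θ₀ κ₁ t w ϖ rL : ℝ} (hϖ : 0 ≤ ϖ) (hκ₁ : 0 < κ₁)
    (hPF : NearPricedSkeletonFloor η R Rc δm ρ₁ θ θ₀ (κ₁ / 2) t w rL) (hFC : ForceContentVisible η R Rc δm ρ₁ θ θ₀ t w) :
    NearLightSkeletonFloor η R Rc δm ρ₁ θ θ₀ κ₁ t w ϖ rL := by
  intro hK hR ν hν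
  obtain ⟨A, hA, cE, hcE, hPF1⟩ := hPF hK hR
  obtain ⟨CL, hCL, hFC1⟩ := hFC hK hR
  obtain ⟨ℓa, hPF2⟩ := hPF1 (ν / 2) (by positivity)
  obtain ⟨ℓb, hFC2⟩ := hFC1 κ₁ hκ₁
  refine ⟨max (max ℓa ℓb) (ϖ + (2 * A * ϖ * CL / ν + A * ϖ / cE + 2 * A * ϖ + 1)), fun ℓ hℓ => ?_⟩
  have hℓa : ℓa ≤ ℓ := le_trans (le_trans (le_max_left _ _) (le_max_left _ _)) hℓ
  have hℓb : ℓb ≤ ℓ := le_trans (le_trans (le_max_right _ _) (le_max_left _ _)) hℓ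
  have hℓM : ϖ + (2 * A * ϖ * CL / ν + A * ϖ / cE + 2 * A * ϖ + 1) ≤ ℓ := le_trans (le_max_right _ _) hℓ
  have hM1 : 0 ≤ 2 * A * ϖ * CL / ν := by positivity
  have hM2 : 0 ≤ A * ϖ / cE := by positivity
  have hM3 : 0 ≤ 2 * A * ϖ := by positivity
  have hϖℓ : ϖ < ℓ := by linarith
  have h1 : 2 * A * ϖ * CL ≤ (ℓ - ϖ) * ν := by
    have : 2 * A * ϖ * CL / ν ≤ ℓ - ϖ := by linarith
    rw [div_le_iff₀ hν] at this
    linarith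
  have h2 : A * ϖ ≤ (ℓ - ϖ) * cE := by
    have : A * ϖ / cE ≤ ℓ - ϖ := by linarith
    rw [div_le_iff₀ hcE] at this
    linarith
  have h3 : 2 * A * ϖ ≤ ℓ - ϖ := by linarith
  obtain ⟨ε₀a, hε₀a, hPF3⟩ := hPF2 ℓ hℓa
  obtain ⟨ε₀b, hε₀b, hFC3⟩ := hFC2 ℓ hℓb
  refine ⟨min ε₀a ε₀b, lt_min hε₀a hε₀b, fun ε₁ hε₁ hle δ hδ hδ2 => ?_⟩
  obtain ⟨C, hC, hPF4⟩ := hPF3 ε₁ hε₁ (hle.trans (min_le_left _ _)) δ hδ hδ2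
  obtain ⟨C', hC', hFC4⟩ := hFC3 ε₁ hε₁ (hle.trans (min_le_right _ _)) δ hδ hδ2
  refine ⟨C + C', by positivity, fun N y hy F z hsk hLW hsupp hcrit hadm => ?_⟩
  have hfc0 : ∀ j, 0 ≤ forceContent θ₀ ρ₁ ε₁ θ δ y j := fun j => forceContent_nonneg θ₀ ρ₁ ε₁ θ δ y j
  have hLW' : _ := hLW
  unfold LightWalls at hLW'
  have hFCv := hFC4 N y hy F z hsk hsupp hcrit hadm
  have hfloor := hPF4 N y hy F z hsk hsupp hcrit hadm
  have hsplit := sum_nearInterior_le_free_wall_collar ℓ rL Rc θ₀ ρ₁ ε₁ θ δ y F hfc0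
  clear hPF4 hFC4 hPF3 hFC3 hPF2 hFC2 hPF1 hFC1 hPF hFC hLW
  have hQ0 := dispGradSum_nonneg (101 / 100) (nearSet θ₀ ρ₁ ε₁ θ δ y) (goodSet ρ₁ ε₁ θ δ y) y z
  have hX : 0 ≤ κ₁ * ((farSet θ₀ ρ₁ ε₁ θ δ y).card : ℝ) + C' * (((goodSet ρ₁ ε₁ θ δ y)ᶜ).card : ℝ) := by positivity
  have hSP : 0 ≤ ∑ j ∈ collarPinned ℓ rL Rc θ₀ ρ₁ ε₁ θ δ y F, forceContent θ₀ ρ₁ ε₁ θ δ y j :=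
    Finset.sum_nonneg fun j _ => hfc0 j
  have hFCv' : ∑ k ∈ F, forceContent θ₀ ρ₁ ε₁ θ δ y k
      ≤ CL * dispGradSum (101 / 100) (nearSet θ₀ ρ₁ ε₁ θ δ y) (goodSet ρ₁ ε₁ θ δ y) y z
        + (κ₁ * ((farSet θ₀ ρ₁ ε₁ θ δ y).card : ℝ) + C' * (((goodSet ρ₁ ε₁ θ δ y)ᶜ).card : ℝ)) := by
    linarith only [hFCv]
  have hwall := wall_absorb hϖ hϖℓ hA hQ0 hSP hX hLW' hsplit hFCv' h1 h2 h3
  have hGc : 0 ≤ C' * (((goodSet ρ₁ ε₁ θ δ y)ᶜ).card : ℝ) := by positivity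
  linarith only [hfloor, hwall, hGc]

/-! ## §4  The cones: RD0c, the record literals, the RDEF shape -/

/-- **K-side → CP⁺ → R0ᴬ → FC → RD0c (PROVED):** through the tree's `nearReferenceCritical_of_lightSkeleton`. [this file] -/
theorem nearReferenceCritical_of_pricedFloor {η R Rc δm ρ₁ θ θ₀ κ₁ t w ϖ rL : ℝ} (hϖ : 0 ≤ ϖ) (hκ₁ : 0 < κ₁)
    (hK : ∃ μ₁ μR : ℝ, 0 < μ₁ ∧ 0 < μR ∧ PureMarginStabilityAt η μ₁ μR R)
    (hCP : NearLightSkeletonEquilibrium η R Rc δm ρ₁ θ θ₀ t w ϖ rL)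
    (hPF : NearPricedSkeletonFloor η R Rc δm ρ₁ θ θ₀ (κ₁ / 2) t w rL) (hFC : ForceContentVisible η R Rc δm ρ₁ θ θ₀ t w) :
    NearReferenceCriticalFloor η R Rc δm ρ₁ θ θ₀ κ₁ :=
  nearReferenceCritical_of_lightSkeleton hK hCP (nearLightSkeletonFloor_of_priced_of_visible hϖ hκ₁ hPF hFC)

/-- **R0⁻ at the record literals from R0ᴬ ∧ FC (PROVED).** [this file] -/
theorem nearLightSkeletonFloor_record_of_priced
    (hPF : NearPricedSkeletonFloor (3 / 2000) 4 6 (1 / 1000) 12 (1 / 25) (1 / 2000) (1 / (4 * 10 ^ 7) / 2) 4 6 12)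
    (hFC : ForceContentVisible (3 / 2000) 4 6 (1 / 1000) 12 (1 / 25) (1 / 2000) 4 6) :
    NearLightSkeletonFloor (3 / 2000) 4 6 (1 / 1000) 12 (1 / 25) (1 / 2000) (1 / (4 * 10 ^ 7)) 4 6 320 12 :=
  nearLightSkeletonFloor_of_priced_of_visible (by norm_num) (by norm_num) hPF hFC

/-- **LINE CONE through the priced floor at the record literals** `(η, R, Rc, δm, ρ₁, θ, θ₀, κ₁, t, w, ϖ, rL) =
(3/2000, 4, 6, 1/1000, 12, 1/25, 1/2000, 1/(4·10⁷), 4, 6, 320, 12)`, R0ᴬ at `κ = κ₁/2`: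
`K_at⁰ ∧ R_aff ∧ CP⁺ ∧ R0ᴬ ∧ FC ∧ N2 ∧ Z ∧ M ⟹ TameBalancedDeepScaleGap (122/125) 0 4 (3/50) (1/450)` through the tree's
`tbdsg_of_nearLightSkeleton_record` / cone of record `tbdsg_of_nearCritical_record'_bt_d` (UNCHANGED). [this file] -/
theorem tbdsg_of_nearPricedFloor_record
    (hK : ∃ μ₁ μR : ℝ, 0 < μ₁ ∧ 0 < μR ∧ PureMarginStabilityAt (3 / 2000) μ₁ μR 4) (hR : AffineChartStraightening)
    (hCP : NearLightSkeletonEquilibrium (3 / 2000) 4 6 (1 / 1000) 12 (1 / 25) (1 / 2000) 4 6 320 12)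
    (hPF : NearPricedSkeletonFloor (3 / 2000) 4 6 (1 / 1000) 12 (1 / 25) (1 / 2000) (1 / (4 * 10 ^ 7) / 2) 4 6 12)
    (hFC : ForceContentVisible (3 / 2000) 4 6 (1 / 1000) 12 (1 / 25) (1 / 2000) 4 6)
    (h2 : NearSecondOrderFloor (3 / 2000) 4 6 (1 / 1000) 12 (1 / 25) (1 / 2000) (1 / (4 * 10 ^ 7)))
    (hZ : FarAggregatePricing 12 (1 / 25) (1 / 2000) (1 / (2 * 10 ^ 7))) (hM : AffMidAll 12 (1 / 25)) :
    TameBalancedDeepScaleGap (122 / 125) 0 4 (3 / 50) (1 / 450) :=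
  tbdsg_of_nearLightSkeleton_record hK hR hCP (nearLightSkeletonFloor_record_of_priced hPF hFC) h2 hZ hM

/-- **The residual RDEF through the priced floor** (record shape; slot 3 now `K_at⁰ ∧ R_aff ∧ CP⁺ ∧ R0ᴬ ∧ FC ∧ N2 ∧ Z ∧ M`; CEG, T, CE, Res are
the other RDEF slots). [this file] -/
theorem rdef_of_ceg_shape_nearPricedFloor_record (hCEG : ChargedEnergyGap) (hT : TwoShellShape (1 / 100) (3 / 50) (1 / 450))
    (hK : ∃ μ₁ μR : ℝ, 0 < μ₁ ∧ 0 < μR ∧ PureMarginStabilityAt (3 / 2000) μ₁ μR 4) (hR : AffineChartStraightening)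
    (hCP : NearLightSkeletonEquilibrium (3 / 2000) 4 6 (1 / 1000) 12 (1 / 25) (1 / 2000) 4 6 320 12)
    (hPF : NearPricedSkeletonFloor (3 / 2000) 4 6 (1 / 1000) 12 (1 / 25) (1 / 2000) (1 / (4 * 10 ^ 7) / 2) 4 6 12)
    (hFC : ForceContentVisible (3 / 2000) 4 6 (1 / 1000) 12 (1 / 25) (1 / 2000) 4 6)
    (h2 : NearSecondOrderFloor (3 / 2000) 4 6 (1 / 1000) 12 (1 / 25) (1 / 2000) (1 / (4 * 10 ^ 7)))
    (hZ : FarAggregatePricing 12 (1 / 25) (1 / 2000) (1 / (2 * 10 ^ 7))) (hM : AffMidAll 12 (1 / 25))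
    (hCE : CleanlessExcessT) (hRes : CoherentResidual 10) : RobustDefectLimitWindows :=
  rdef_of_ceg_shape_balancedDeep_record hCEG hT (tbdsg_of_nearPricedFloor_record hK hR hCP hPF hFC h2 hZ hM) hCE hRes

end Summit.AtomisticToContinuum.Crystallization.Theorems.OverbindingBudgetAffineNearCluster
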